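import Summits.CriticalPhenomena.PercolationContinuityZ3.Theorems.PercLowPointHalfSpaceQuantitativeBGNThinFootReshape
import HarnessLib

/-!
# Strategist s2 (session F) sketch — the MONOTONE ENVELOPE of the thin child of `QuantitativeBGN`

Crux `stmt-CriticalPhenomena-0913` =
`Summit.CriticalPhenomena.PercolationContinuityZ3.Theses.PercLowPointHalfSpace.QuantitativeBGN`
(`∃ a C, 0 < a ∧ ∀ r ≥ 1, P_{p_c(ℤ³)}(arm_H(0,r)) ≤ C r^{-a}`).

Leads c4/c5 and strategist s1 cut the crux EXACTLY into `FootprintTail ∧ ThinFootHigh`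
(`quantitativeBGN_iff_footprintTail_and_thinFootHigh`, landed p138124). This sketch records, kernel-checked,
that the thin corner `ThinFootHigh` (a NON-monotone event: "high AND few wall contacts") may be replaced by
its monotone envelope

* `HeightTail : ∃ a C, 0 < a ∧ ∀ k ≥ 1, P_{p_c}(∃ v ∈ C_H(0), v₀ ≥ k) ≤ C k^{-a}`
  — the HEIGHT (normal extent) of the critical half-space cluster has a polynomial tail —

without losing exactness: `QuantitativeBGN ⟺ FootprintTail ∧ HeightTail` (both children necessary, jointly
sufficient). `HeightTail` is an increasing event, false for every `p > p_c` like the crux itself (θ_H(p) > 0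
gives a floor), and sits between the two: `QuantitativeBGN ⟹ HeightTail ⟹ ThinFootHigh`; the converse
`HeightTail ⟹ QuantitativeBGN` is NOT claimed (it needs the fat child: wide-but-flat clusters are excluded only
through the footprint tail + the slab-volume transport of c5).

Everything below is a re-typing of landed theorems plus two inclusions of events; no new mathematics, no sorry.
All three children are spelled over the Literature vocabulary `halfSpaceCluster` / `halfSpaceFootprint`
(`Literature/Probability/Percolation/HalfSpacePinnedPairs.lean`), definitionally equal to the WallDefs
vocabulary `clusterH ω 0` / `footAt ω 0` / `footGe 0 n` of the Theorems files.
-/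

noncomputable section

namespace Summit.CriticalPhenomena.PercolationContinuityZ3.Cruxes.QuantitativeBGN.StrategistS2F

open MeasureTheory Literature.Probability.Percolation Literature.Probability.LatticeModels
open Summit.CriticalPhenomena.PercolationContinuityZ3.Theorems
open Summit.CriticalPhenomena.PercolationContinuityZ3.Theorems.WallGhost
open Summit.CriticalPhenomena.PercolationContinuityZ3.Theses.PercLowPointHalfSpace (QuantitativeBGN)
open scoped ENNReal

/-- FAT child (c4/s1): the wall footprint `F = |C_H(0) ∩ ∂H|` has a polynomial tail at `p_c(ℤ³)`. -/
def FootprintTail : Prop :=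
  ∃ θ B : ℝ, 0 < θ ∧ ∀ n : ℕ, 1 ≤ n →
    (bondPercolation (zdGraph 3) (criticalProbI 3)).real
      {ω | (n : ℕ∞) ≤ halfSpaceFootprint ω} ≤ B * (n : ℝ) ^ (-θ)

/-- THIN child, corner form (c5/s1): thin-footed HIGH clusters are polynomially rare. -/
def ThinFootHigh : Prop :=
  ∃ a δ C : ℝ, 0 < a ∧ 0 < δ ∧ ∀ k : ℕ, 1 ≤ k →
    (bondPercolation (zdGraph 3) (criticalProbI 3)).real
      ({ω | ∃ v ∈ halfSpaceCluster ω, (k : ℤ) ≤ v 0} ∩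
        {ω | halfSpaceFootprint ω ≤ ((⌊(k : ℝ) ^ δ⌋₊ : ℕ) : ℕ∞)}) ≤ C * (k : ℝ) ^ (-a)

/-- THIN child, monotone envelope (this sketch): the HEIGHT of `C_H(0)` has a polynomial tail at `p_c(ℤ³)`. -/
def HeightTail : Prop :=
  ∃ a C : ℝ, 0 < a ∧ ∀ k : ℕ, 1 ≤ k →
    (bondPercolation (zdGraph 3) (criticalProbI 3)).real
      {ω | ∃ v ∈ halfSpaceCluster ω, (k : ℤ) ≤ v 0} ≤ C * (k : ℝ) ^ (-a)

/-- `HeightTail ⟹ ThinFootHigh` (drop the thinness constraint; any `δ > 0`, here `δ = 1`). [folklore] -/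
theorem thinFootHigh_of_heightTail (h : HeightTail) : ThinFootHigh := by
  obtain ⟨a, C, ha, h⟩ := h
  exact ⟨a, 1, C, ha, one_pos, fun k hk =>
    le_trans (measureReal_mono Set.inter_subset_left) (h k hk)⟩

/-- `QuantitativeBGN ⟹ HeightTail` (a vertex at height `≥ k` is at sup-distance `≥ k`): the envelope is a
NECESSARY part of the crux. [folklore] -/
theorem heightTail_of_quantitativeBGN (h : QuantitativeBGN) : HeightTail := by
  obtain ⟨a, C, ha, h⟩ := h
  refine ⟨a, C, ha, fun k hk => le_trans (measureReal_mono ?_) (h k hk)⟩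
  rintro ω ⟨v, hv, hvk⟩
  exact ⟨v, ⟨0, hvk.trans (le_abs_self _)⟩, hv⟩

/-- `QuantitativeBGN ⟹ FootprintTail` (landed `footprintTail_of_quantitativeBGN`, re-typed). [folklore] -/
theorem footprintTail_of_quantitativeBGN' (h : QuantitativeBGN) : FootprintTail :=
  footprintTail_of_quantitativeBGN h

/-- **Glue of the envelope split**: `FootprintTail → HeightTail → QuantitativeBGN`
(through `ThinFootHigh` and the landed exact cut). [folklore] -/
theorem quantitativeBGN_of_footprintTail_of_heightTail (hF : FootprintTail) (hH : HeightTail) :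
    QuantitativeBGN :=
  quantitativeBGN_iff_footprintTail_and_thinFootHigh.2 ⟨hF, thinFootHigh_of_heightTail hH⟩

/-- **The envelope split is exact**: `QuantitativeBGN ⟺ FootprintTail ∧ HeightTail`. [folklore] -/
theorem quantitativeBGN_iff_footprintTail_and_heightTail :
    QuantitativeBGN ↔ (FootprintTail ∧ HeightTail) :=
  ⟨fun h => ⟨footprintTail_of_quantitativeBGN' h, heightTail_of_quantitativeBGN h⟩,
    fun h => quantitativeBGN_of_footprintTail_of_heightTail h.1 h.2⟩

/-- The three-way ordering of the thin statements: `QuantitativeBGN ⟹ HeightTail ⟹ ThinFootHigh`. [folklore] -/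
theorem thin_chain : (QuantitativeBGN → HeightTail) ∧ (HeightTail → ThinFootHigh) :=
  ⟨heightTail_of_quantitativeBGN, thinFootHigh_of_heightTail⟩

end Summit.CriticalPhenomena.PercolationContinuityZ3.Cruxes.QuantitativeBGN.StrategistS2F

end
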